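import Summits.QuantumFields.YangMills.Theorems.SwapVirialDeficitBlowUpLimitShell
import HarnessLib

/-!
# The abstract blow-up shell, III: domination ALMOST EVERYWHERE (the form brick J4 delivers)
# (free-hands support of ⟨stmt-QuantumFields-24197⟩ `SwapVirialDeficit.SwapGluedStiffness`; sequel of ✓`SwapVirialDeficitBlowUpLimitShell` §5)

✓`BlowUp.ae_one_le_sigmaDom_dil3_of_mem` (brick J4, leader half) bounds the blown-up leader event by w3 g63's dilated dominator only off a `β`-null set
(hub `a = 0`, first pair letter `x = 0`).  The shell's weight-dominated forms (§5) ask `1 ≤ Φ` on `E r u` for EVERY point; this file relaxes them to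
`β`-a.e.:

* ★★ `tendsto_measure_blowUp_of_weight_ae` — `β(E u) → β T`, `β T < ∞` under `∀ᶠ u, ∀ᵐ x, x ∈ E u → 1 ≤ Φ x`, `∫Φ < ∞`, and a.e. eventual membership;
* ★★★ `smallBall_limit_real_of_blowUp_of_weight_ae` — scaling (S) + a.e. weight domination (D″) + pointwise (P) + floor ⟹ `∃ v > 0, μ.real{F ≤ u}/u^α → v`,
  the hypothesis of ✓`SwapRing.tendsto_meanAction_of_principalLimit`.

HONEST LABEL: pure measure theory (plan-level plumbing); NOT the fixed-`L` sharp law, NOT ⟨24197⟩; the Yang–Mills mass gap is NOT proved; no summit is proved by a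
line.  Seat ym-line-fcl-p3 g45 (cell ym-idea-1, free hands; item of record ⟨24085⟩ aside, untouched), `--supports stmt-QuantumFields-24197`.
THEOREMS ONLY (0 `def`, 0 `sorry`), standard axioms.  References: [folklore].
-/

set_option autoImplicit false

noncomputable section

open MeasureTheory Set Filter Topology
open scoped ENNReal

namespace Summit.QuantumFields.YangMills.Theorems.SwapVirialDeficit.BlowUp

variable {Ω B : Type*} [MeasurableSpace Ω] [MeasurableSpace B]

/-- ★★ **The blown-up events converge, a.e.-weight-dominated form**: as ✓`tendsto_measure_blowUp_of_weight`, with `1 ≤ Φ` on `E u` required only for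
`β`-a.e. point, for all small `u > 0`. [folklore] -/
theorem tendsto_measure_blowUp_of_weight_ae (β : Measure B) {E : ℝ → Set B} (hE : ∀ u, MeasurableSet (E u)) {Φ : B → ℝ≥0∞}
    (hΦ : ∫⁻ x, Φ x ∂β ≠ ∞) (hsub : ∀ᶠ u in 𝓝[>] (0 : ℝ), ∀ᵐ x ∂β, x ∈ E u → 1 ≤ Φ x) {T : Set B} (hT : MeasurableSet T)
    (hpt : ∀ᵐ x ∂β, ∀ᶠ u in 𝓝[>] (0 : ℝ), (x ∈ E u ↔ x ∈ T)) :
    Tendsto (fun u : ℝ => β (E u)) (𝓝[>] (0 : ℝ)) (𝓝 (β T)) ∧ β T ≠ ∞ := by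
  have hI : ∀ u, β (E u) = ∫⁻ x, (E u).indicator (1 : B → ℝ≥0∞) x ∂β := fun u => (lintegral_indicator_one (hE u)).symm
  have hIT : β T = ∫⁻ x, T.indicator (1 : B → ℝ≥0∞) x ∂β := (lintegral_indicator_one hT).symm
  have hdom : ∀ᶠ u in 𝓝[>] (0 : ℝ), ∀ᵐ x ∂β, (E u).indicator (1 : B → ℝ≥0∞) x ≤ Φ x := by
    filter_upwards [hsub] with u hu
    filter_upwards [hu] with x hx
    by_cases hxE : x ∈ E u
    · rw [indicator_of_mem hxE, Pi.one_apply]; exact hx hxE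
    · rw [indicator_of_notMem hxE]; exact bot_le
  have hT' : Tendsto (fun u : ℝ => ∫⁻ x, (E u).indicator (1 : B → ℝ≥0∞) x ∂β) (𝓝[>] (0 : ℝ))
      (𝓝 (∫⁻ x, T.indicator (1 : B → ℝ≥0∞) x ∂β)) := by
    refine tendsto_lintegral_filter_of_dominated_convergence Φ ?_ hdom hΦ ?_
    · exact Eventually.of_forall fun u => measurable_one.indicator (hE u)
    · filter_upwards [hpt] with x hx
      refine (tendsto_congr' ?_).2 tendsto_const_nhds
      filter_upwards [hx] with u hu
      by_cases hm : x ∈ T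
      · rw [indicator_of_mem (hu.2 hm), indicator_of_mem hm]
      · rw [indicator_of_notMem hm, indicator_of_notMem (fun h => hm (hu.1 h))]
  have hmain : Tendsto (fun u : ℝ => β (E u)) (𝓝[>] (0 : ℝ)) (𝓝 (β T)) := by
    rw [hIT]
    simpa only [hI] using hT'
  refine ⟨hmain, ?_⟩
  have hle : β T ≤ ∫⁻ x, Φ x ∂β := by
    refine le_of_tendsto hmain ?_
    filter_upwards [hdom] with u hu
    rw [hI u]
    exact lintegral_mono_ae hu
  exact ne_top_of_le_ne_top hΦ hle

/-- ★★★ **SMALL-BALL LIMIT FROM A BLOW-UP, a.e.-weight-dominated `μ.real` form with positivity**: the scaling (S), the a.e. weight domination (D″)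
`∀ r > 0, ∃ Φ_r, ∫Φ_r < ∞ ∧ ∀ᶠ u, β-a.e. (x ∈ E r u → 1 ≤ Φ_r x)`, the pointwise limit (P) on an s-finite blow-up space and a floor `c·u^α ≤ μ.real{F ≤ u}`
on `(0, u₀]` give `∃ v > 0, μ.real{F ≤ u}/u^α → v`. [folklore] -/
theorem smallBall_limit_real_of_blowUp_of_weight_ae (μ : Measure Ω) {F : Ω → ℝ} {α κ : ℝ} (hκ : 0 ≤ κ)
    (β : Measure B) [SFinite β] {E : ℝ → ℝ → Set B} (hEm : ∀ r u, MeasurableSet (E r u))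
    (hS : ∀ r u : ℝ, 0 < r → 0 < u → μ {ω | F ω ≤ r * u} = ENNReal.ofReal (κ * u ^ α) * β (E r u))
    (hD : ∀ r : ℝ, 0 < r → ∃ Φ : B → ℝ≥0∞, ∫⁻ x, Φ x ∂β ≠ ∞ ∧ ∀ᶠ u in 𝓝[>] (0 : ℝ), ∀ᵐ x ∂β, x ∈ E r u → 1 ≤ Φ x)
    {G : B → ℝ} (hG : Measurable G) {Dom₀ : Set B} (hDom : MeasurableSet Dom₀)
    (hP : ∀ᵐ x ∂β, ∀ r : ℝ, 0 < r → G x ≠ r → ∀ᶠ u in 𝓝[>] (0 : ℝ), (x ∈ E r u ↔ (x ∈ Dom₀ ∧ G x < r)))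
    {c u₀ : ℝ} (hc : 0 < c) (hu₀ : 0 < u₀) (hfloor : ∀ u : ℝ, 0 < u → u ≤ u₀ → c * u ^ α ≤ μ.real {ω | F ω ≤ u}) :
    ∃ v : ℝ, 0 < v ∧ Tendsto (fun u : ℝ => μ.real {ω | F ω ≤ u} / u ^ α) (𝓝[>] (0 : ℝ)) (𝓝 v) := by
  obtain ⟨r, hr, hgood⟩ := exists_good_level β hG (show (1 : ℝ) < 2 by norm_num)
  have hr0 : 0 < r := lt_trans one_pos hr.1
  set T : Set B := Dom₀ ∩ {x | G x < r} with hTdef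
  have hT : MeasurableSet T := hDom.inter (measurableSet_lt hG measurable_const)
  obtain ⟨Φ, hΦfin, hsub⟩ := hD r hr0
  have hpt : ∀ᵐ x ∂β, ∀ᶠ u in 𝓝[>] (0 : ℝ), (x ∈ E r u ↔ x ∈ T) := by
    have hne : ∀ᵐ x ∂β, G x ≠ r := by
      rw [ae_iff]
      simpa only [ne_eq, not_not] using hgood
    filter_upwards [hP, hne] with x hx hxr
    exact hx r hr0 hxr
  obtain ⟨hconv, hTfin⟩ := tendsto_measure_blowUp_of_weight_ae β (fun u => hEm r u) hΦfin hsub hT hpt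
  have hscale : Tendsto (fun u : ℝ => u / r) (𝓝[>] (0 : ℝ)) (𝓝[>] (0 : ℝ)) := by
    refine tendsto_nhdsWithin_iff.2 ⟨?_, ?_⟩
    · have h : Tendsto (fun u : ℝ => u / r) (𝓝 (0 : ℝ)) (𝓝 (0 / r)) := (continuous_id.div_const r).tendsto 0
      rw [zero_div] at h
      exact h.mono_left nhdsWithin_le_nhds
    · filter_upwards [self_mem_nhdsWithin] with u hu using div_pos hu hr0
  have hreal : Tendsto (fun u : ℝ => (β (E r (u / r))).toReal) (𝓝[>] (0 : ℝ)) (𝓝 (β T).toReal) :=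
    ((ENNReal.tendsto_toReal hTfin).comp hconv).comp hscale
  have hlim := hreal.const_mul (κ * r ^ (-α))
  have hT2 : Tendsto (fun u : ℝ => (μ {ω | F ω ≤ u}).toReal / u ^ α) (𝓝[>] (0 : ℝ)) (𝓝 (κ * r ^ (-α) * (β T).toReal)) := by
    refine (tendsto_congr' ?_).2 hlim
    filter_upwards [self_mem_nhdsWithin] with u hu
    have hu0 : (0 : ℝ) < u := hu
    have hur : 0 < u / r := div_pos hu0 hr0
    have hset : {ω | F ω ≤ u} = {ω | F ω ≤ r * (u / r)} := by
      rw [mul_div_cancel₀ u hr0.ne']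
    rw [hset, hS r (u / r) hr0 hur, ENNReal.toReal_mul, ENNReal.toReal_ofReal (by positivity)]
    have hpow : (u / r) ^ α = u ^ α * r ^ (-α) := by
      rw [Real.div_rpow hu0.le hr0.le, Real.rpow_neg hr0.le, div_eq_mul_inv]
    have huα : u ^ α ≠ 0 := (Real.rpow_pos_of_pos hu0 α).ne'
    rw [hpow]
    field_simp
  have hv' : Tendsto (fun u : ℝ => μ.real {ω | F ω ≤ u} / u ^ α) (𝓝[>] (0 : ℝ)) (𝓝 (κ * r ^ (-α) * (β T).toReal)) := by
    simpa only [measureReal_def] using hT2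
  refine ⟨_, smallBall_limit_pos_of_floor μ hc hu₀ (fun u hu hu' => ?_) hT2, hv'⟩
  rw [← measureReal_def]; exact hfloor u hu hu'

end Summit.QuantumFields.YangMills.Theorems.SwapVirialDeficit.BlowUp

end
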